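import Literature.Analysis.FluidPDE.SereginZajaczkowski2007SwirlEnergyEstimates
import HarnessLib

/-!
# Seregin–Zajaczkowski 2007, Lemma 4.3: the `L⁴`-energy bound (4.18) — discharged

G. Seregin, W. Zajaczkowski, *A sufficient condition of regularity for axially symmetric
solutions to the Navier–Stokes equations*, SIAM J. Math. Anal. 39 (2007) 669–685 =
arXiv:math/0702720, §4, proof of Lemma 4.3 (arXiv p. 6): "It, together with the statement of
Lemma 4.2 at `q = 4`, implies `sup_{-(7/4)²≤t≤0} ∫_{𝒞̃₁}|β̃(x,t)|² dx + ∫_{Q̃₁}|∇β̃|² dz ≤ Φ₅(𝒜₂)`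
(4.18). So, (4.14) follows from (4.17) and (4.18). Lemma 4.3 is proved."

This proofs-only file DISCHARGES the named fact `SwirlL4EnergyBound` ((4.18),
`SereginZajaczkowski2007Swirl.lean`) — `SwirlL4EnergyBound_holds` — and with it Lemma 4.3
(`OffAxisSwirlL6Bound_holds`, through the accepted `offAxisSwirlL6Bound_of_swirlL4EnergyBound`) and
Corollary 4.4 (`OffAxisL6Bound_holds`, through the accepted `offAxisL6Bound_of_swirlL4EnergyBound`,
Lemma 4.2 being discharged). The chain:

1. the swirl equation (4.15) with a classical `∂ₜ` (`hasDerivAt_swirl`, from the discharged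
   `SwirlEquation_holds`) and the density `∂ₜ(α̃⁴)` (`SereginZajaczkowski2007SwirlEnergyTools.lean`);
2. the identity (4.16) at each fixed time, by three integrations by parts
   (`SereginZajaczkowski2007SwirlEnergyIdentity.lean`);
3. the estimates of `J₁`, `J₂` by Young's inequality, (4.17) and Lemma 4.2, giving the main
   inequality in kernel form (`SereginZajaczkowski2007SwirlEnergyEstimates.lean`);
4. here: the fundamental theorem of calculus in `t` for each `x` and Fubini turn
   `Y(t) = ∫ β̃(t)² = ∫ α̃(t)⁴` into `∫_{t₀}^{t} ∫ ∂ₛ(α̃⁴)` (`integral_betaTilde_sq_eq`; the density and the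
   dissipation integrand are continuous on the slab `]-2², 0[ × ℝ³` because they vanish off the
   compact `C ⊂ 𝒞̃`, `continuousOn_slab_of_eq_zero`), the real inequality passes to `ℝ≥0∞`
   (`ofReal_integral_le_lintegral_ofReal'`), `Y` is bounded on `[-(7/4)², T]`
   (`exists_swirlEnergy_le`), and the integrated main inequality `swirlEnergy_add_le` is exactly the
   hypothesis of the Grönwall step;
5. Grönwall's lemma with the `L¹` kernel `∫_𝒞̃|∇V(·,t)|²`, the limit `t ↑ 0` and Tonelli
   (`swirlL4EnergyBound_of_energyInequality`, `SereginZajaczkowski2007SwirlGronwall.lean`).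

No definitions, no named facts.

## References

* G. Seregin, W. Zajaczkowski, SIAM J. Math. Anal. 39 (2007) 669–685, arXiv:math/0702720, §4:
  Lemma 4.2, Lemma 4.3 ((4.14)) and its proof ((4.15)–(4.18)), Cor. 4.4 ((4.19)) (arXiv pp. 5–6).
  [`SereginZajaczkowski2007`]
-/

noncomputable section

open MeasureTheory Set Function Filter Topology TopologicalSpace Metric WithLp
open scoped NNReal ENNReal ContDiff InnerProductSpace RealInnerProductSpace Laplacian

namespace Literature.Analysis.FluidPDE

namespace SereginZajaczkowski2007

open SereginSverak2009

/-- Local notation for physical space `ℝ³ = EuclideanSpace ℝ (Fin 3)`. -/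
local notation "ℝ³" => EuclideanSpace ℝ (Fin 3)

/-- Local notation: the shell `𝒞̃ = 𝒞(1/4, 3; 2)`. -/
local notation "𝒞" => shell (1 / 4) 3 2

/-- Local notation: the cylinder `Q̃ = 𝒞̃ × ]-2², 0[` as an open set. -/
local notation "Q" => shellCylOpens (1 / 4) 3 2 2

/-- Local notation: the shell `𝒞̃₁ = 𝒞(5/16, 11/4; 7/4)`. -/
local notation "S₁" => shell (5 / 16) (11 / 4) (7 / 4)

/-! ### Space–time continuity on slabs of functions vanishing off `C` -/

/-- **Continuity on a slab.** If `F` is continuous on `I × 𝒞̃` (`I` open) and `F(s, x) = 0`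
whenever `x ∉ C`, `C` a closed subset of the open shell `𝒞̃`, then `F` is continuous on `I × ℝ³`
(near a point with `x ∉ 𝒞̃` it vanishes identically). [folklore] -/
theorem continuousOn_slab_of_eq_zero {E : Type*} [TopologicalSpace E] [Zero E]
    {F : ℝ × ℝ³ → E} {C : Set ℝ³} {I : Set ℝ} (hI : IsOpen I) (hC : IsClosed C) (hC𝒞 : C ⊆ 𝒞)
    (hF : ContinuousOn F (I ×ˢ 𝒞)) (hzero : ∀ (s : ℝ) (x : ℝ³), x ∉ C → F (s, x) = 0) :
    ContinuousOn F (I ×ˢ (univ : Set ℝ³)) := by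
  intro z hz
  by_cases hx : z.2 ∈ 𝒞
  · have hz' : z ∈ I ×ˢ 𝒞 := ⟨hz.1, hx⟩
    have ho : I ×ˢ 𝒞 ∈ 𝓝 z := (hI.prod (isOpen_shell _ _ _)).mem_nhds hz'
    exact (hF.continuousAt ho).continuousWithinAt
  · have hxC : z.2 ∉ C := fun h => hx (hC𝒞 h)
    have hU : (univ : Set ℝ) ×ˢ Cᶜ ∈ 𝓝 z :=
      (isOpen_univ.prod hC.isOpen_compl).mem_nhds ⟨mem_univ _, hxC⟩
    have h0 : F =ᶠ[𝓝 z] fun _ => 0 := by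
      filter_upwards [hU] with w hw
      have : F (w.1, w.2) = 0 := hzero w.1 w.2 hw.2
      simpa using this
    exact (continuousAt_const.congr h0.symm).continuousWithinAt

section TimeDependence

variable {ψ : ℝ × ℝ³ → ℝ} {C : Set ℝ³} {t₀ M : ℝ}
variable {V : ℝ → ℝ³ → ℝ³} {P : ℝ → ℝ³ → ℝ}

namespace SwirlCutoffData

variable (d : SwirlCutoffData ψ C t₀ M)
include d

/-- The density vanishes off `C`. [folklore] -/
theorem l4Density_eq_zero (V : ℝ → ℝ³ → ℝ³) (s : ℝ) {x : ℝ³} (hx : x ∉ C) :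
    l4Density ψ V s x = 0 := by
  rw [l4Density, d.alphaTilde_eq_zero V s hx]
  ring

/-- **The density `∂ₜ(α̃⁴)` is continuous on the slab `]-2², 0[ × ℝ³`.** [folklore] -/
theorem continuousOn_l4Density_slab (hV : IsSmoothAxisymmetricSolutionOn Q V P) :
    ContinuousOn (fun z : ℝ × ℝ³ => l4Density ψ V z.1 z.2)
      (Ioo (-(2 : ℝ) ^ 2) 0 ×ˢ (univ : Set ℝ³)) := by
  have h := continuousOn_alphaTilde_pow_four_timeDeriv d.contDiff hV
  rw [coe_Q_eq_prod] at h
  refine continuousOn_slab_of_eq_zero isOpen_Ioo d.isCompact.isClosed d.subset_shell ?_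
    fun s x hx => d.l4Density_eq_zero V s hx
  refine h.congr fun z _ => ?_
  simp only [l4Density, Prod.mk.eta]

/-- The dissipation integrand vanishes off `C`. [folklore] -/
theorem fderiv_betaTilde_eq_zero (V : ℝ → ℝ³ → ℝ³) (s : ℝ) {x : ℝ³} (hx : x ∉ C) :
    fderiv ℝ (betaTilde ψ V s) x = 0 := by
  have hts : tsupport (betaTilde ψ V s) ⊆ C :=
    closure_minimal (fun y hy => by_contra fun h' => hy (d.betaTilde_eq_zero' V s h'))
      d.isCompact.isClosed
  exact fderiv_of_notMem_tsupport ℝ fun h => hx (hts h)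

/-- **The dissipation integrand `‖∇ₓβ̃‖²` is continuous on the slab `]-2², 0[ × ℝ³`.** [folklore] -/
theorem continuousOn_dissipation_slab (hV : IsSmoothAxisymmetricSolutionOn Q V P) :
    ContinuousOn (fun z : ℝ × ℝ³ => ‖fderiv ℝ (betaTilde ψ V z.1) z.2‖ ^ 2)
      (Ioo (-(2 : ℝ) ^ 2) 0 ×ˢ (univ : Set ℝ³)) := by
  have h := continuousOn_fderiv_betaTilde d.contDiff hV
  rw [← coe_shellCylOpens, coe_Q_eq_prod] at h
  refine continuousOn_slab_of_eq_zero isOpen_Ioo d.isCompact.isClosed d.subset_shell (h.norm.pow 2)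
    fun s x hx => ?_
  show ‖fderiv ℝ (betaTilde ψ V s) x‖ ^ 2 = 0
  rw [d.fderiv_betaTilde_eq_zero V s hx, norm_zero, zero_pow two_ne_zero]

/-- `α̃` is continuous on the slab `]-2², 0[ × ℝ³`. [folklore] -/
theorem continuousOn_alphaTilde_slab (hV : IsSmoothAxisymmetricSolutionOn Q V P) :
    ContinuousOn (fun z : ℝ × ℝ³ => alphaTilde ψ V z.1 z.2)
      (Ioo (-(2 : ℝ) ^ 2) 0 ×ˢ (univ : Set ℝ³)) := by
  have h := continuousOn_alphaTilde d.contDiff hV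
  rw [← coe_shellCylOpens, coe_Q_eq_prod] at h
  exact continuousOn_slab_of_eq_zero isOpen_Ioo d.isCompact.isClosed d.subset_shell h
    fun s x hx => d.alphaTilde_eq_zero V s hx

/-- **The time derivative of `α̃⁴` at every point** (on `𝒞̃` by the swirl equation; elsewhere both
vanish): for `-2² < r < 0`, `∂ᵣ (α̃(r, x)⁴) = l4Density ψ V r x`. [folklore] -/
theorem hasDerivAt_alphaTilde_pow_four_everywhere (hV : IsSmoothAxisymmetricSolutionOn Q V P)
    {r : ℝ} (hr : r ∈ Ioo (-(2 : ℝ) ^ 2) 0) (x : ℝ³) :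
    HasDerivAt (fun s => alphaTilde ψ V s x ^ 4) (l4Density ψ V r x) r := by
  by_cases hx : x ∈ 𝒞
  · exact hasDerivAt_alphaTilde_pow_four_l4Density d.contDiff hV hx hr
  · have hxC : x ∉ C := fun h => hx (d.subset_shell h)
    have heq : (fun s => alphaTilde ψ V s x ^ 4) = fun _ => 0 := by
      funext s
      rw [d.alphaTilde_eq_zero V s hxC, zero_pow four_ne_zero]
    rw [heq, d.l4Density_eq_zero V r hxC]
    exact hasDerivAt_const r 0

/-- **The energy as a time integral** (fundamental theorem of calculus in `t` for each `x`, then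
Fubini): for `t₀ < t < 0`, `∫ β̃(t, x)² dx = ∫_{]t₀, t[} (∫ ∂ₛ(α̃⁴)(s, x) dx) ds`.
[cite: SereginZajaczkowski2007, proof of Lemma 4.3, (4.16) (the term ¼∂ₜ∫|α̃|⁴, integrated in time)] -/
theorem integral_betaTilde_sq_eq (hV : IsSmoothAxisymmetricSolutionOn Q V P) {t : ℝ}
    (ht₀t : t₀ < t) (ht : t < 0) :
    ∫ x, betaTilde ψ V t x ^ 2 = ∫ s in Ioo t₀ t, ∫ x, l4Density ψ V s x := by
  have ht₀4 : -(2 : ℝ) ^ 2 < t₀ := by linarith [d.lt_t₀]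
  have hsub : Icc t₀ t ⊆ Ioo (-(2 : ℝ) ^ 2) 0 :=
    fun s hs => ⟨lt_of_lt_of_le ht₀4 hs.1, lt_of_le_of_lt hs.2 ht⟩
  have hcu := d.continuousOn_alphaTilde_slab (V := V) hV
  have hcd := d.continuousOn_l4Density_slab (V := V) hV
  -- FTC in `t` for each `x`
  have hFTC : ∀ x, ∫ s in t₀..t, l4Density ψ V s x = betaTilde ψ V t x ^ 2 := by
    intro x
    have hc : ContinuousOn (fun τ => ((τ, x) : ℝ × ℝ³)) (Icc t₀ t) :=
      (continuous_id.prodMk continuous_const).continuousOn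
    have hmaps : MapsTo (fun τ => ((τ, x) : ℝ × ℝ³)) (Icc t₀ t) (Ioo (-(2 : ℝ) ^ 2) 0 ×ˢ univ) :=
      fun τ hτ => ⟨hsub hτ, mem_univ _⟩
    have hcont : ContinuousOn (fun τ => alphaTilde ψ V τ x ^ 4) (Icc t₀ t) :=
      ((hcu.comp hc hmaps).pow 4).congr fun τ _ => rfl
    have hcont' : ContinuousOn (fun τ => l4Density ψ V τ x) (Icc t₀ t) :=
      (hcd.comp hc hmaps).congr fun τ _ => rfl
    have h := intervalIntegral.integral_eq_sub_of_hasDerivAt_of_le ht₀t.le hcont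
      (fun τ hτ => d.hasDerivAt_alphaTilde_pow_four_everywhere hV (hsub (Ioo_subset_Icc_self hτ)) x)
      (hcont'.intervalIntegrable_of_Icc ht₀t.le)
    have h0 : alphaTilde ψ V t₀ x = 0 := by
      rw [alphaTilde, d.tzero t₀ le_rfl x, zero_mul]
    rw [h, h0, betaTilde_sq_eq_alphaTilde_pow_four]
    ring
  -- Fubini
  have hint : Integrable (uncurry fun s x => l4Density ψ V s x)
      (((volume : Measure ℝ).restrict (Ioo t₀ t)).prod (volume : Measure ℝ³)) :=
    integrable_prod_of_continuousOn (G := fun z : ℝ × ℝ³ => l4Density ψ V z.1 z.2) d.isCompact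
      (hcd.mono (prod_mono hsub Subset.rfl)) fun s _ x hx => d.l4Density_eq_zero V s hx
  have hswap := integral_integral_swap hint
  calc ∫ x, betaTilde ψ V t x ^ 2 = ∫ x, ∫ s in Ioo t₀ t, l4Density ψ V s x := by
        refine integral_congr_ae (Eventually.of_forall fun x => ?_)
        show betaTilde ψ V t x ^ 2 = ∫ s in Ioo t₀ t, l4Density ψ V s x
        rw [← hFTC x, intervalIntegral.integral_of_le ht₀t.le, integral_Ioc_eq_integral_Ioo]
    _ = ∫ s in Ioo t₀ t, ∫ x, l4Density ψ V s x := hswap.symm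

/-- `s ↦ ∫ ∂ₛ(α̃⁴)(s, x) dx` is integrable on `]t₀, t[`, `t < 0`. [folklore] -/
theorem integrableOn_integral_l4Density (hV : IsSmoothAxisymmetricSolutionOn Q V P) {t : ℝ}
    (ht : t < 0) : IntegrableOn (fun s => ∫ x, l4Density ψ V s x) (Ioo t₀ t) := by
  have ht₀4 : -(2 : ℝ) ^ 2 < t₀ := by linarith [d.lt_t₀]
  have hsub : Icc t₀ t ⊆ Ioo (-(2 : ℝ) ^ 2) 0 :=
    fun s hs => ⟨lt_of_lt_of_le ht₀4 hs.1, lt_of_le_of_lt hs.2 ht⟩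
  have hint : Integrable (uncurry fun s x => l4Density ψ V s x)
      (((volume : Measure ℝ).restrict (Ioo t₀ t)).prod (volume : Measure ℝ³)) :=
    integrable_prod_of_continuousOn (G := fun z : ℝ × ℝ³ => l4Density ψ V z.1 z.2) d.isCompact
      ((d.continuousOn_l4Density_slab (V := V) hV).mono (prod_mono hsub Subset.rfl))
      fun s _ x hx => d.l4Density_eq_zero V s hx
  exact hint.integral_prod_left

/-- `s ↦ ∫ ‖∇ₓβ̃(s, x)‖² dx` is integrable on `]t₀, t[`, `t < 0`. [folklore] -/
theorem integrableOn_integral_dissipation (hV : IsSmoothAxisymmetricSolutionOn Q V P) {t : ℝ}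
    (ht : t < 0) :
    IntegrableOn (fun s => ∫ x, ‖fderiv ℝ (betaTilde ψ V s) x‖ ^ 2) (Ioo t₀ t) := by
  have ht₀4 : -(2 : ℝ) ^ 2 < t₀ := by linarith [d.lt_t₀]
  have hsub : Icc t₀ t ⊆ Ioo (-(2 : ℝ) ^ 2) 0 :=
    fun s hs => ⟨lt_of_lt_of_le ht₀4 hs.1, lt_of_le_of_lt hs.2 ht⟩
  have hint : Integrable (uncurry fun s x => ‖fderiv ℝ (betaTilde ψ V s) x‖ ^ 2)
      (((volume : Measure ℝ).restrict (Ioo t₀ t)).prod (volume : Measure ℝ³)) :=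
    integrable_prod_of_continuousOn
      (G := fun z : ℝ × ℝ³ => ‖fderiv ℝ (betaTilde ψ V z.1) z.2‖ ^ 2) d.isCompact
      ((d.continuousOn_dissipation_slab (V := V) hV).mono (prod_mono hsub Subset.rfl))
      fun s _ x hx => by
        show ‖fderiv ℝ (betaTilde ψ V s) x‖ ^ 2 = 0
        rw [d.fderiv_betaTilde_eq_zero V s hx, norm_zero, zero_pow two_ne_zero]
  exact hint.integral_prod_left

/-- **Boundedness of the energy on `[-(7/4)², T]`, `T < 0`** (`α̃` is continuous on the compact
`[t₀, T] × C` and vanishes for `t ≤ t₀` and off `C`). [folklore] -/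
theorem exists_swirlEnergy_le (hV : IsSmoothAxisymmetricSolutionOn Q V P) {T : ℝ}
    (hT : T ∈ Ioo (-(7 / 4 : ℝ) ^ 2) 0) :
    ∃ Mb : ℝ≥0, ∀ t ∈ Icc (-(7 / 4 : ℝ) ^ 2) T, swirlEnergy ψ V t ≤ Mb := by
  have ht₀4 : -(2 : ℝ) ^ 2 < t₀ := by linarith [d.lt_t₀]
  -- a bound for `|α̃|` on `[t₀, T] × C`
  have hsub : Icc t₀ T ×ˢ C ⊆ Ioo (-(2 : ℝ) ^ 2) 0 ×ˢ (univ : Set ℝ³) :=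
    prod_mono (fun t ht => ⟨lt_of_lt_of_le ht₀4 ht.1, lt_of_le_of_lt ht.2 hT.2⟩) (subset_univ _)
  obtain ⟨S, hS⟩ := (isCompact_Icc.prod d.isCompact).exists_bound_of_continuousOn
    ((d.continuousOn_alphaTilde_slab (V := V) hV).mono hsub)
  have hvol : volume S₁ < ⊤ := lt_of_le_of_lt (measure_mono shell_one_subset_tilde) volume_shell_lt_top
  refine ⟨(ENNReal.ofReal (S ^ 4) * volume S₁).toNNReal, fun t ht => ?_⟩
  rw [ENNReal.coe_toNNReal (ENNReal.mul_ne_top ENNReal.ofReal_ne_top hvol.ne)]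
  by_cases htt : t ≤ t₀
  · rw [swirlEnergy_eq_zero_of_forall_eq_zero (d.tzero t htt) V]
    exact bot_le
  · have htt : t₀ < t := lt_of_not_ge htt
    have hpt : ∀ x, ‖betaTilde ψ V t x‖ₑ ^ 2 ≤ ENNReal.ofReal (S ^ 4) := by
      intro x
      rw [Real.enorm_eq_ofReal (betaTilde_nonneg _ _ _ _), ← ENNReal.ofReal_pow
        (betaTilde_nonneg _ _ _ _)]
      refine ENNReal.ofReal_le_ofReal ?_
      rw [betaTilde_sq_eq_alphaTilde_pow_four]
      by_cases hx : x ∈ C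
      · have h := hS (t, x) ⟨⟨htt.le, ht.2⟩, hx⟩
        rw [Real.norm_eq_abs] at h
        calc alphaTilde ψ V t x ^ 4 = |alphaTilde ψ V t x| ^ 4 := by
              rw [show (4 : ℕ) = 2 * 2 from rfl, pow_mul, pow_mul, sq_abs]
          _ ≤ S ^ 4 := pow_le_pow_left₀ (abs_nonneg _) h 4
      · rw [d.alphaTilde_eq_zero V t hx, zero_pow four_ne_zero]
        positivity
    calc swirlEnergy ψ V t ≤ ∫⁻ _ in S₁, ENNReal.ofReal (S ^ 4) :=
          setLIntegral_mono' (isOpen_shell _ _ _).measurableSet fun x _ => hpt x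
      _ = ENNReal.ofReal (S ^ 4) * volume S₁ := setLIntegral_const _ _

/-- Before the switch-on time the dissipation vanishes. [folklore] -/
theorem swirlDissipation_eq_zero_of_le (V : ℝ → ℝ³ → ℝ³) {s : ℝ} (hs : s ≤ t₀) :
    swirlDissipation ψ V s = 0 := by
  unfold swirlDissipation
  have hb : betaTilde ψ V s = fun _ => 0 := betaTilde_eq_zero_of_forall_eq_zero (d.tzero s hs) V
  have h0 : ∀ x : ℝ³, ‖fderiv ℝ (betaTilde ψ V s) x‖ₑ ^ 2 = 0 := fun x => by
    rw [hb, fderiv_const_apply, ← ofReal_norm, norm_zero, ENNReal.ofReal_zero, zero_pow two_ne_zero]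
  simp_rw [h0]
  rw [lintegral_zero]

/-- The dissipation integral over `]-(7/4)², t[` only sees `]t₀, t[`. [folklore] -/
theorem setLIntegral_swirlDissipation_eq (V : ℝ → ℝ³ → ℝ³) (t : ℝ) :
    ∫⁻ s in Ioo (-(7 / 4 : ℝ) ^ 2) t, swirlDissipation ψ V s =
      ∫⁻ s in Ioo t₀ t, swirlDissipation ψ V s := by
  have hind : ∀ s, swirlDissipation ψ V s = (Ioi t₀).indicator (swirlDissipation ψ V) s := by
    intro s
    by_cases hs : s ∈ Ioi t₀
    · rw [indicator_of_mem hs]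
    · rw [indicator_of_notMem hs, d.swirlDissipation_eq_zero_of_le V (not_lt.1 hs)]
  have hset : Ioi t₀ ∩ Ioo (-(7 / 4 : ℝ) ^ 2) t = Ioo t₀ t := by
    ext s
    constructor
    · rintro ⟨h1, h2⟩
      exact ⟨h1, h2.2⟩
    · rintro ⟨h1, h2⟩
      exact ⟨h1, ⟨lt_trans d.lt_t₀ h1, h2⟩⟩
  calc ∫⁻ s in Ioo (-(7 / 4 : ℝ) ^ 2) t, swirlDissipation ψ V s
      = ∫⁻ s in Ioo (-(7 / 4 : ℝ) ^ 2) t, (Ioi t₀).indicator (swirlDissipation ψ V) s :=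
        lintegral_congr fun s => hind s
    _ = ∫⁻ s in Ioo t₀ t, swirlDissipation ψ V s := by
        rw [lintegral_indicator measurableSet_Ioi, Measure.restrict_restrict measurableSet_Ioi, hset]

/-- **The integrated `L⁴`-energy inequality** (the hypothesis of
`swirlL4EnergyBound_of_energyInequality`): for `-(7/4)² < t < 0`,
`Y(t) + ∫_{-(7/4)²}^{t} D ≤ ∫_{-(7/4)²}^{t} A(K)(1 + ∫_𝒞̃|∇V(·,s)|²)(1 + Y(s)) ds`.
[cite: SereginZajaczkowski2007, proof of Lemma 4.3 (the main inequality, integrated in time)] -/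
theorem swirlEnergy_add_le (hψ : IsSwirlCutoff ψ) (hV : IsSmoothAxisymmetricSolutionOn Q V P)
    {K : ℝ≥0} (hK : szEnergy V P (fun t x => fderiv ℝ (V t) x) ≤ K) {t : ℝ}
    (ht : t ∈ Ioo (-(7 / 4 : ℝ) ^ 2) 0) :
    swirlEnergy ψ V t + ∫⁻ s in Ioo (-(7 / 4 : ℝ) ^ 2) t, swirlDissipation ψ V s ≤
      ∫⁻ s in Ioo (-(7 / 4 : ℝ) ^ 2) t,
        (l4KernelConst M K : ℝ≥0∞) * (1 + shellGradEnergy V s) * (1 + swirlEnergy ψ V s) := by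
  have ht4 := mem_Ioo_four_of_mem ht
  by_cases htt : t ≤ t₀
  · have hY : swirlEnergy ψ V t = 0 := swirlEnergy_eq_zero_of_forall_eq_zero (d.tzero t htt) V
    have hD : ∫⁻ s in Ioo (-(7 / 4 : ℝ) ^ 2) t, swirlDissipation ψ V s = 0 := by
      refine (setLIntegral_congr_fun measurableSet_Ioo (fun s hs => ?_)).trans lintegral_zero
      exact d.swirlDissipation_eq_zero_of_le V (hs.2.le.trans htt)
    rw [hY, hD, zero_add]
    exact zero_le
  have htt : t₀ < t := lt_of_not_ge htt
  -- the real quantities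
  have hYeq := d.swirlEnergy_eq_ofReal hV ht4
  have hFTC := d.integral_betaTilde_sq_eq hV htt ht.2
  have iI := d.integrableOn_integral_l4Density hV ht.2 (t := t)
  have iD := d.integrableOn_integral_dissipation hV ht.2 (t := t)
  have hD0 : ∀ s, 0 ≤ ∫ x, ‖fderiv ℝ (betaTilde ψ V s) x‖ ^ 2 := fun s =>
    integral_nonneg fun x => sq_nonneg _
  have hsub4 : Ioo t₀ t ⊆ Ioo (-(2 : ℝ) ^ 2) 0 := fun s hs =>
    ⟨by linarith [d.lt_t₀, hs.1], lt_trans hs.2 ht.2⟩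
  -- the dissipation integral in real form
  have hDeq : ∫⁻ s in Ioo (-(7 / 4 : ℝ) ^ 2) t, swirlDissipation ψ V s =
      ENNReal.ofReal (∫ s in Ioo t₀ t, ∫ x, ‖fderiv ℝ (betaTilde ψ V s) x‖ ^ 2) := by
    rw [d.setLIntegral_swirlDissipation_eq V t]
    rw [setLIntegral_congr_fun measurableSet_Ioo (fun s hs => d.swirlDissipation_eq_ofReal hV (hsub4 hs))]
    exact (ofReal_integral_eq_lintegral_ofReal iD (Eventually.of_forall hD0)).symm
  have hY0 : 0 ≤ ∫ x, betaTilde ψ V t x ^ 2 := integral_nonneg fun x => sq_nonneg _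
  have hDint0 : 0 ≤ ∫ s in Ioo t₀ t, ∫ x, ‖fderiv ℝ (betaTilde ψ V s) x‖ ^ 2 :=
    integral_nonneg fun s => hD0 s
  have hsum : (∫ x, betaTilde ψ V t x ^ 2) + ∫ s in Ioo t₀ t, ∫ x, ‖fderiv ℝ (betaTilde ψ V s) x‖ ^ 2 =
      ∫ s in Ioo t₀ t, ((∫ x, l4Density ψ V s x) + ∫ x, ‖fderiv ℝ (betaTilde ψ V s) x‖ ^ 2) := by
    rw [hFTC, ← integral_add iI iD]
  calc swirlEnergy ψ V t + ∫⁻ s in Ioo (-(7 / 4 : ℝ) ^ 2) t, swirlDissipation ψ V s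
      = ENNReal.ofReal ((∫ x, betaTilde ψ V t x ^ 2) +
          ∫ s in Ioo t₀ t, ∫ x, ‖fderiv ℝ (betaTilde ψ V s) x‖ ^ 2) := by
        rw [hYeq, hDeq, ← ENNReal.ofReal_add hY0 hDint0]
    _ = ENNReal.ofReal (∫ s in Ioo t₀ t,
          ((∫ x, l4Density ψ V s x) + ∫ x, ‖fderiv ℝ (betaTilde ψ V s) x‖ ^ 2)) := by rw [hsum]
    _ ≤ ∫⁻ s in Ioo t₀ t, ENNReal.ofReal
          ((∫ x, l4Density ψ V s x) + ∫ x, ‖fderiv ℝ (betaTilde ψ V s) x‖ ^ 2) :=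
        ofReal_integral_le_lintegral_ofReal' (iI.add iD)
    _ ≤ ∫⁻ s in Ioo t₀ t,
          (l4KernelConst M K : ℝ≥0∞) * (1 + shellGradEnergy V s) * (1 + swirlEnergy ψ V s) :=
        setLIntegral_mono' measurableSet_Ioo fun s hs =>
          d.ofReal_integral_l4Density_add_le hψ hV hK ⟨lt_trans d.lt_t₀ hs.1, lt_trans hs.2 ht.2⟩
    _ ≤ ∫⁻ s in Ioo (-(7 / 4 : ℝ) ^ 2) t,
          (l4KernelConst M K : ℝ≥0∞) * (1 + shellGradEnergy V s) * (1 + swirlEnergy ψ V s) :=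
        lintegral_mono_set (Ioo_subset_Ioo d.lt_t₀.le le_rfl)

end SwirlCutoffData

end TimeDependence

/-! ### The discharge -/

/-- **Seregin–Zajaczkowski 2007, proof of Lemma 4.3, estimate (4.18) — discharged.** For every
cut-off `ψ` of the printed kind take its data `(C, t₀, M)` (`IsSwirlCutoff.exists_swirlCutoffData`)
and the monotone kernel constant `A = l4KernelConst M`; for the class of Prop. 4.1 with `𝒜₂ ≤ K`
the `L⁴`-energy is bounded on every `[-(7/4)², T]` (`exists_swirlEnergy_le`) and obeys the
integrated main inequality (`swirlEnergy_add_le`: the swirl equation (4.15), the identity (4.16),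
the estimates of `J₁`, `J₂` by Young's inequality, (4.17) and Lemma 4.2, then the fundamental
theorem of calculus in `t` and Fubini); Grönwall's lemma (`swirlL4EnergyBound_of_energyInequality`)
gives (4.18). [cite: SereginZajaczkowski2007, proof of Lemma 4.3, (4.15)–(4.18)] -/
theorem SwirlL4EnergyBound_holds : SwirlL4EnergyBound := by
  refine swirlL4EnergyBound_of_energyInequality fun ψ hψ => ?_
  obtain ⟨C, t₀, M, d⟩ := hψ.exists_swirlCutoffData
  exact ⟨l4KernelConst M, monotone_l4KernelConst M, fun V P hV K hK =>
    ⟨fun T hT => d.exists_swirlEnergy_le hV hT, fun t ht => d.swirlEnergy_add_le hψ hV hK ht⟩⟩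

/-- **Seregin–Zajaczkowski 2007, Lemma 4.3 — discharged** (`∫_{Q̃₂} |V_φ|⁶ dz ≤ Φ₅(𝒜₂)`): the
accepted reduction `offAxisSwirlL6Bound_of_swirlL4EnergyBound` applied to (4.18).
[cite: SereginZajaczkowski2007, Lemma 4.3 ((4.14))] -/
theorem OffAxisSwirlL6Bound_holds : OffAxisSwirlL6Bound :=
  offAxisSwirlL6Bound_of_swirlL4EnergyBound SwirlL4EnergyBound_holds

/-- **Seregin–Zajaczkowski 2007, Corollary 4.4 — discharged** (`∫_{Q̃₂} |V|⁶ dz ≤ Φ₆(𝒜₂)`): the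
accepted `offAxisL6Bound_of_swirlL4EnergyBound` (Lemma 4.2 proved, Lemma 4.3 from (4.18)) applied
to (4.18). [cite: SereginZajaczkowski2007, Cor. 4.4 ((4.19))] -/
theorem OffAxisL6Bound_holds : OffAxisL6Bound :=
  offAxisL6Bound_of_swirlL4EnergyBound SwirlL4EnergyBound_holds

end SereginZajaczkowski2007

end Literature.Analysis.FluidPDE
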